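import Literature.Probability.RandomPlanarGeometry.ConformalRestrictionHolds
import Literature.Probability.RandomPlanarGeometry.ConformalRestrictionLocal
import Literature.Probability.RandomPlanarGeometry.ConformalRestrictionLeaf
import Literature.Probability.RandomPlanarGeometry.ConformalRestrictionLoewner
import Literature.Probability.RandomPlanarGeometry.HullRestrictionSLEHolds
import Literature.Probability.RandomPlanarGeometry.CritPercSLESimplePathHolds
import Literature.Probability.RandomPlanarGeometry.SLEExistenceNeEightHolds
import HarnessLib

/-!
# Crux `MassiveWindowSLE` (stmt-CriticalPhenomena-7685), line `registered` (skeleton r10):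
stub `stub_hullRestrictionOfAvoidRestriction` — avoidance-form restriction ⇒ hull restriction

Route `SAWMassiveIsingTilt` of `CriticalPhenomena/SAWScalingLimit`; stub T' (identification glue) of
the line `registered` (`Cruxes/MassiveWindowSLE/Lines/birth.lean`, r10, lead c4). Objects: a chordal
family `P : DobrushinDomain → Measure (CurveClass ℂ)` and, for a hull subdomain `D'` of `D`, the
AVOIDANCE event `{γ | Disjoint γ.range (cl (D ∖ D'))}` ("the trace misses the removed hull") next to
the tree's CLOSED conditioning event `{γ ⊆ cl D'}` of `ChordalFamily.IsHullRestriction`; the two differ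
by the touching event `{γ ⊆ cl D', γ ∩ cl (D ∖ D') ≠ ∅}` (NoTouch).

Why this file exists. The line's restriction-from-mass engine produces the two-sided restriction
identity in AVOIDANCE form (`P D' (T) · P D (avoid) = P D (T ∩ avoid)`) with no boundary estimate,
whereas the closed form needed an unprinted near-touch estimate (r5–r9 stub 3a). But the tree's proof
of [LSW03] p. 5 result 2 (uniqueness of the restriction family carried by simple curves) consumes
hull restriction ONLY through avoidance probabilities of pulled-back hulls
(`RestrictionPullback.pullbackLaw_avoid_hullProduct`), so the avoidance form already identifies `P`
with the chordal SLE_{8/3} family, which has closed-form hull restriction ([LSW03] Thm. 6.1,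
`IsSLELaw.hullRestriction_eightThirds_holds`). This file PROVES (sorry-free, standard axioms):

* `har_disjoint_of_mem_chordalCarrier`, `har_mem_chordalCarrier_of_disjoint` — on the chordal
  carrier of `D`, avoiding `cl (D ∖ D')` is being a chordal curve of `D'`;
* `har_pullbackLaw_avoid_hullProduct` — the avoidance-form twin of
  `ChordalFamily.pullbackLaw_avoid_hullProduct`: `P̃ {K ∩ (A · A') = ∅} = P̃ {K ∩ A = ∅} P̃ {K ∩ A' = ∅}`
  (same proof, minus the NoTouch step `ae_mem_chordalCarrier_of_rangeSubset`);
* `har_isArcHullMultiplicative_pullbackLaw`, `har_isRestrictionMeasure_pullbackLaw` — the pull-back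
  law is multiplicative over smooth hulls, hence (Lemma 2.1, Prop. 3.3, Cor. 8.6, all PROVED in the
  tree) is `P_{5/8}`;
* `har_eq_of_lsw` — such a `P` agrees in every domain with any chordal, covariant, hull-restriction
  family carried by simple curves (the anchored-test-set transfer of
  `LawlerSchrammWerner2003_unique_of_facts'`);
* `stub_hullRestrictionOfAvoidRestriction` — the registered stub T': chordal + conformally covariant +
  avoidance-form restriction + carried by simple curves ⇒ `P.IsHullRestriction` (compare with the
  SLE_{8/3} family `ChordalFamily.spec_of_isSLELaw_eightThirds`).

References: G. F. Lawler, O. Schramm, W. Werner, *Conformal restriction: the chordal case*, J. Amer.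
Math. Soc. 16 (2003) 917–955, p. 5 result 2, Prop. 3.3, Thm. 6.1, Cor. 8.6. No named fact is used.
-/

noncomputable section

namespace Summit.CriticalPhenomena.SAWScalingLimit.Theorems.MassiveWindowSLE.Birth

open scoped Topology NNReal ENNReal
open Filter Set MeasureTheory Metric
open Literature.Probability Literature.Probability.RandomPlanarGeometry
open Literature.Probability.RandomPlanarGeometry.RestrictionConfig
open UpperHalfPlane (upperHalfPlaneSet)

/-! ### Avoiding the removed hull on the chordal carrier -/

/-- A chordal curve of the hull subdomain `D'` misses `cl (D ∖ D')`: its trace lies in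
`D' ∪ {a, b}`, the open `D'` misses `cl (D ∖ D')`, and so do the marked points. -/
theorem har_disjoint_of_mem_chordalCarrier {D D' : DobrushinDomain} (hD' : D.IsHullSubdomain D')
    {c : CurveClass ℂ} (hc : c ∈ chordalCarrier D') :
    Disjoint c.range (closure (D.carrier \ D'.carrier)) := by
  have hr : c.range ⊆ D'.carrier ∪ {D'.pt 0, D'.pt 1} := hc.2
  have hsub : closure (D.carrier \ D'.carrier) ⊆ D'.carrierᶜ :=
    closure_minimal (fun z hz => hz.2) D'.isOpen.isClosed_compl
  refine Set.disjoint_left.2 fun w hw hwK => ?_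
  rcases hr hw with h | h
  · exact hsub hwK h
  · rw [hD'.pt_zero_eq, hD'.pt_one_eq] at h
    rcases h with h | h
    · exact hD'.pt_zero_notMem (h ▸ hwK)
    · exact hD'.pt_one_notMem ((mem_singleton_iff.1 h) ▸ hwK)

/-- A chordal curve of `D` missing `cl (D ∖ D')` is a chordal curve of `D'`. -/
theorem har_mem_chordalCarrier_of_disjoint {D D' : DobrushinDomain} (hD' : D.IsHullSubdomain D')
    {c : CurveClass ℂ} (hc : c ∈ chordalCarrier D)
    (hdisj : Disjoint c.range (closure (D.carrier \ D'.carrier))) : c ∈ chordalCarrier D' := by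
  have hr : c.range ⊆ D.carrier ∪ {D.pt 0, D.pt 1} := hc.2
  refine ⟨⟨⟨hc.1.1.1, ?_⟩, ?_⟩, fun w hw => ?_⟩
  · show c.source = D'.pt 0
    rw [hD'.pt_zero_eq]; exact hc.1.1.2
  · show c.target = D'.pt 1
    rw [hD'.pt_one_eq]; exact hc.1.2
  · rcases hr hw with hwD | hab
    · by_cases hwD' : w ∈ D'.carrier
      · exact Or.inl hwD'
      · exact (Set.disjoint_left.1 hdisj hw
          (subset_closure (show w ∈ D.carrier \ D'.carrier from ⟨hwD, hwD'⟩))).elim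
    · rw [hD'.pt_zero_eq, hD'.pt_one_eq]
      exact Or.inr hab

/-! ### The pull-back law is multiplicative, from the avoidance form -/

/-- **Avoidance-form restriction over `D'` makes the pull-back law multiplicative at the
pulled-back hull `A' = closure (ℍ ∖ φ⁻¹ D')`**: for every `A ∈ 𝒬*`,
`P̃ {K ∩ (A · A') = ∅} = P̃ {K ∩ A = ∅} · P̃ {K ∩ A' = ∅}`. The proof of
`ChordalFamily.pullbackLaw_avoid_hullProduct` with the closed event `{γ ⊆ cl D'}` replaced by the
avoidance event, to which it is pointwise equivalent on the chordal carrier. -/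
theorem har_pullbackLaw_avoid_hullProduct {P : ChordalFamily} (hP : P.IsChordal)
    (hcov : P.IsConformallyCovariant)
    (hres : ∀ (D D' : DobrushinDomain), D.IsHullSubdomain D' → ∀ T : Set (CurveClass ℂ),
      MeasurableSet T →
        P D' T * P D {γ | Disjoint γ.range (closure (D.carrier \ D'.carrier))} =
          P D (T ∩ {γ | Disjoint γ.range (closure (D.carrier \ D'.carrier))}))
    (hS : P.IsCarriedBySimpleCurves)
    (hJarc : Literature.Topology.PlaneTopology.JordanArcSeparation)
    (hC : JordanDomain.exists_continuousOn_extension)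
    (hsc : ∀ D : JordanDomain, D.isSimplyConnected)
    (hRM : ∀ {U : Set ℂ}, exists_conformalEquiv_ball (U := U))
    {D D' : DobrushinDomain} {φ : ConformalEquiv upperHalfPlaneSet D.carrier}
    (hφ : D.IsChordalUniformizing φ) (hD' : D.IsHullSubdomain D')
    {Φ : ConformalEquiv (upperHalfPlaneSet \ φ.pullbackHull D') upperHalfPlaneSet}
    (hΦ : IsRestrictionMap (φ.pullbackHull D') Φ) {A : Set ℂ} (hA : IsStarHull A) :
    ChordalFamily.pullbackLaw P D φ hJarc hC hφ
        (RestrictionConfig.avoid (hullProduct A (φ.pullbackHull D') Φ)) =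
      ChordalFamily.pullbackLaw P D φ hJarc hC hφ (RestrictionConfig.avoid A) *
        ChordalFamily.pullbackLaw P D φ hJarc hC hφ
          (RestrictionConfig.avoid (φ.pullbackHull D')) := by
  have hcar : ∀ D : DobrushinDomain, ∀ᵐ c ∂P D, c ∈ chordalCarrier D :=
    ChordalFamily.ae_mem_chordalCarrier hP hS
  have hA' : IsStarHull (φ.pullbackHull D') := IsStarHull.pullbackHull hsc hφ hD'
  have hAc : IsClosed A := hA.isBoundedHull.isClosed
  have hB : IsStarHull (hullProduct A (φ.pullbackHull D') Φ) := hA.hullProduct hA' hΦ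
  set ψ : ConformalEquiv upperHalfPlaneSet D'.carrier :=
    Φ.symm.trans (φ.restrHull D' hD'.carrier_subset) with hψdef
  have hψ : D'.IsChordalUniformizing ψ :=
    MarkedDomain.IsChordalUniformizing.pullback hsc hRM hC hφ hD' hΦ
  set T : Set (CurveClass ℂ) := pullbackConfig hJarc hC hψ ⁻¹' RestrictionConfig.avoid A
    with hTdef
  have hTm : MeasurableSet T :=
    measurable_pullbackConfig (RestrictionConfig.measurableSet_avoid hA)
  set V : Set (CurveClass ℂ) := {γ | Disjoint γ.range (closure (D.carrier \ D'.carrier))}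
    with hVdef
  -- Step 1: the left-hand event is `T ∩ V` a.e.
  have hL : ChordalFamily.pullbackLaw P D φ hJarc hC hφ
      (RestrictionConfig.avoid (hullProduct A (φ.pullbackHull D') Φ)) = P D (T ∩ V) := by
    rw [ChordalFamily.pullbackLaw_apply _ (RestrictionConfig.measurableSet_avoid hB)]
    refine measure_congr ?_
    filter_upwards [hcar D] with c hc
    refine propext ?_
    change pullbackConfig hJarc hC hφ c ∈
        RestrictionConfig.avoid (hullProduct A (φ.pullbackHull D') Φ) ↔ c ∈ T ∩ V
    rw [pullbackConfig_mem_avoid_iff hc]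
    constructor
    · intro h
      have hdisj : Disjoint (φ.pullbackTrace c) (φ.pullbackHull D') := by
        by_contra h'
        exact not_disjoint_hullProduct_of_not_disjoint (ConformalEquiv.pullbackTrace_subset c) h' h
      have hc' : c ∈ chordalCarrier D' := (disjoint_pullbackTrace_pullbackHull_iff hD' hc).1 hdisj
      refine ⟨?_, har_disjoint_of_mem_chordalCarrier hD' hc'⟩
      change pullbackConfig hJarc hC hψ c ∈ RestrictionConfig.avoid A
      rw [pullbackConfig_mem_avoid_iff hc', hψdef, pullbackTrace_pullback_eq hD' hc']
      exact (disjoint_hullProduct_iff_of_disjoint hAc (ConformalEquiv.pullbackTrace_subset c)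
        hdisj).1 h
    · rintro ⟨hT, hV⟩
      have hc' : c ∈ chordalCarrier D' := har_mem_chordalCarrier_of_disjoint hD' hc hV
      have hdisj : Disjoint (φ.pullbackTrace c) (φ.pullbackHull D') :=
        (disjoint_pullbackTrace_pullbackHull_iff hD' hc).2 hc'
      change pullbackConfig hJarc hC hψ c ∈ RestrictionConfig.avoid A at hT
      rw [pullbackConfig_mem_avoid_iff hc', hψdef, pullbackTrace_pullback_eq hD' hc'] at hT
      exact (disjoint_hullProduct_iff_of_disjoint hAc (ConformalEquiv.pullbackTrace_subset c)
        hdisj).2 hT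
  -- Step 2: restriction in avoidance form
  have hR : P D (T ∩ V) = P D' T * P D V := (hres D D' hD' T hTm).symm
  -- Step 3: `P D' T = P̃ (avoid A)` by transport
  have h3 : P D' T = ChordalFamily.pullbackLaw P D φ hJarc hC hφ (RestrictionConfig.avoid A) := by
    rw [← ChordalFamily.pullbackLaw_eq_of_covariant hcov hcar hJarc hC hφ hψ,
      ChordalFamily.pullbackLaw_apply _ (RestrictionConfig.measurableSet_avoid hA)]
  -- Step 4: `P D V = P̃ (avoid A')`
  have h4 : P D V = ChordalFamily.pullbackLaw P D φ hJarc hC hφ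
      (RestrictionConfig.avoid (φ.pullbackHull D')) := by
    rw [ChordalFamily.pullbackLaw_apply _ (RestrictionConfig.measurableSet_avoid hA')]
    refine measure_congr ?_
    filter_upwards [hcar D] with c hc
    refine propext ⟨fun hV => ?_, fun h => ?_⟩
    · change pullbackConfig hJarc hC hφ c ∈ RestrictionConfig.avoid (φ.pullbackHull D')
      rw [pullbackConfig_mem_avoid_iff hc, disjoint_pullbackTrace_pullbackHull_iff hD' hc]
      exact har_mem_chordalCarrier_of_disjoint hD' hc hV
    · change pullbackConfig hJarc hC hφ c ∈ RestrictionConfig.avoid (φ.pullbackHull D') at h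
      rw [pullbackConfig_mem_avoid_iff hc, disjoint_pullbackTrace_pullbackHull_iff hD' hc] at h
      exact har_disjoint_of_mem_chordalCarrier hD' h
  rw [hL, hR, h3, h4]

/-- **Avoidance-form restriction ⇒ multiplicativity over smooth hulls** for the pull-back law
(as `ChordalFamily.isArcHullMultiplicative_pullbackLaw`, every smooth `*`-hull being the pulled-back
hull of a Jordan hull subdomain, `exists_isHullSubdomain_pullbackHull_eq`). -/
theorem har_isArcHullMultiplicative_pullbackLaw {P : ChordalFamily} (hP : P.IsChordal)
    (hcov : P.IsConformallyCovariant)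
    (hres : ∀ (D D' : DobrushinDomain), D.IsHullSubdomain D' → ∀ T : Set (CurveClass ℂ),
      MeasurableSet T →
        P D' T * P D {γ | Disjoint γ.range (closure (D.carrier \ D'.carrier))} =
          P D (T ∩ {γ | Disjoint γ.range (closure (D.carrier \ D'.carrier))}))
    (hS : P.IsCarriedBySimpleCurves)
    (hJCT : Literature.Topology.PlaneTopology.JordanCurveTheorem)
    (hJarc : Literature.Topology.PlaneTopology.JordanArcSeparation)
    (hC : JordanDomain.exists_continuousOn_extension)
    (hsc : ∀ D : JordanDomain, D.isSimplyConnected)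
    (hRM : ∀ {U : Set ℂ}, exists_conformalEquiv_ball (U := U))
    (hexΦ : IsStarHull.existsUnique_isRestrictionMap)
    {D : DobrushinDomain} {φ : ConformalEquiv upperHalfPlaneSet D.carrier}
    (hφ : D.IsChordalUniformizing φ) :
    IsArcHullMultiplicative (ChordalFamily.pullbackLaw P D φ hJarc hC hφ) := by
  intro A J B hA hJa hJs hB
  obtain ⟨D', hD', hJeq⟩ := exists_isHullSubdomain_pullbackHull_eq hJCT hC hφ hJa hJs.zero_notMem
  subst hJeq
  obtain ⟨Φ, hΦ, -⟩ := hexΦ hJs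
  rw [avoid_eq_avoid_hullProduct hexΦ hA hJs hB hΦ]
  exact har_pullbackLaw_avoid_hullProduct hP hcov hres hS hJarc hC hsc hRM hφ hD' hΦ hA

/-- **The pull-back law of an avoidance-restriction family carried by simple curves is `P_{5/8}`**
([LSW03] Prop. 3.3 (1) ⇒ (3) and p. 5 result 2, first sentence — as
`ChordalFamily.isRestrictionMeasure_pullbackLaw'`, with Lemma 2.1 proved). -/
theorem har_isRestrictionMeasure_pullbackLaw {P : ChordalFamily} (hP : P.IsChordal)
    (hcov : P.IsConformallyCovariant)
    (hres : ∀ (D D' : DobrushinDomain), D.IsHullSubdomain D' → ∀ T : Set (CurveClass ℂ),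
      MeasurableSet T →
        P D' T * P D {γ | Disjoint γ.range (closure (D.carrier \ D'.carrier))} =
          P D (T ∩ {γ | Disjoint γ.range (closure (D.carrier \ D'.carrier))}))
    (hS : P.IsCarriedBySimpleCurves)
    (hJCT : Literature.Topology.PlaneTopology.JordanCurveTheorem)
    (hJarc : Literature.Topology.PlaneTopology.JordanArcSeparation)
    (hC : JordanDomain.exists_continuousOn_extension)
    (hsc : ∀ D : JordanDomain, D.isSimplyConnected)
    (hRM : ∀ {U : Set ℂ}, exists_conformalEquiv_ball (U := U))
    (hexΦ : IsStarHull.existsUnique_isRestrictionMap)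
    (hFa : isSimplyConnected_of_isConnected_compl)
    (hfac : IsStarHull.exists_isHullProduct_plus_minus)
    (h33 : exists_isRestrictionMeasure_of_isHullMultiplicative)
    (h58 : IsRestrictionMeasure.eq_five_eighths_of_outer_simple)
    {D : DobrushinDomain} {φ : ConformalEquiv upperHalfPlaneSet D.carrier}
    (hφ : D.IsChordalUniformizing φ) :
    IsRestrictionMeasure (5 / 8) (ChordalFamily.pullbackLaw P D φ hJarc hC hφ) := by
  haveI : IsProbabilityMeasure (P D) := (hP D).1
  have hcar : ∀ D : DobrushinDomain, ∀ᵐ c ∂P D, c ∈ chordalCarrier D :=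
    ChordalFamily.ae_mem_chordalCarrier hP hS
  have hscale := ChordalFamily.isScaleInvariant_pullbackLaw hcov hcar hJarc hC hφ
  have harc := har_isArcHullMultiplicative_pullbackLaw hP hcov hres hS hJCT hJarc hC hsc hRM hexΦ hφ
  have hmult := harc.isHullMultiplicative' hfac hexΦ hFa
  obtain ⟨α, -, hαP⟩ := h33 _ inferInstance hscale hmult
  have hα : α = 5 / 8 := h58 hαP fun T hT hsub => by
    rw [ChordalFamily.pullbackLaw_apply _ hT]
    have : pullbackConfig hJarc hC hφ ⁻¹' T = univ :=
      eq_univ_of_forall fun c => hsub (isSimplePath_pullbackConfig c)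
    rw [this, measure_univ]
  subst hα
  exact hαP

/-- **An avoidance-restriction family carried by simple curves agrees with every LSW family**:
if `P` is chordal, conformally covariant, has avoidance-form restriction over hull subdomains and is
carried by simple curves, and `Q` is chordal, conformally covariant, has (closed-form) hull
restriction and is carried by simple curves, then `P D = Q D` for every Dobrushin domain. Both
pull-back laws are `P_{5/8}` (`har_isRestrictionMeasure_pullbackLaw`,
`ChordalFamily.isRestrictionMeasure_pullbackLaw'`), so they have the same avoidance probabilities of
`*`-hulls, and two laws carried by the chordal carrier with the same avoidance probabilities of the
anchored test sets coincide (`CurveClass.Measure.ext_of_missCode_injOn`) — the assembly of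
`LawlerSchrammWerner2003_unique_of_facts'`, fed with the tree's discharges of every leaf fact. -/
theorem har_eq_of_lsw {P Q : ChordalFamily} (hP : P.IsChordal) (hPcov : P.IsConformallyCovariant)
    (hPres : ∀ (D D' : DobrushinDomain), D.IsHullSubdomain D' → ∀ T : Set (CurveClass ℂ),
      MeasurableSet T →
        P D' T * P D {γ | Disjoint γ.range (closure (D.carrier \ D'.carrier))} =
          P D (T ∩ {γ | Disjoint γ.range (closure (D.carrier \ D'.carrier))}))
    (hPS : P.IsCarriedBySimpleCurves) (hQ : Q.IsChordal) (hQcov : Q.IsConformallyCovariant)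
    (hQres : Q.IsHullRestriction) (hQS : Q.IsCarriedBySimpleCurves) (D : DobrushinDomain) :
    P D = Q D := by
  have hJCT : Literature.Topology.PlaneTopology.JordanCurveTheorem := Literature.Topology.PlaneTopology.JordanCurveTheorem_holds
  have hJarc : Literature.Topology.PlaneTopology.JordanArcSeparation := Literature.Topology.PlaneTopology.JordanArcSeparation_holds
  have hC : JordanDomain.exists_continuousOn_extension :=
    JordanDomain.exists_continuousOn_extension_holds
  have hsc : ∀ D : JordanDomain, D.isSimplyConnected := JordanDomain.isSimplyConnected_holds
  have hRM : ∀ {U : Set ℂ}, exists_conformalEquiv_ball (U := U) := exists_conformalEquiv_ball_holds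
  have hexΦ : IsStarHull.existsUnique_isRestrictionMap :=
    IsStarHull.existsUnique_isRestrictionMap_holds
  have hex : IsStarHull.exists_hasRestrictionDeriv := IsStarHull.exists_hasRestrictionDeriv_holds
  have hFa : isSimplyConnected_of_isConnected_compl := isSimplyConnected_of_isConnected_compl_holds
  have hfac : IsStarHull.exists_isHullProduct_plus_minus :=
    IsStarHull.exists_isHullProduct_plus_minus_holds
  have h33 : exists_isRestrictionMeasure_of_isHullMultiplicative :=
    exists_isRestrictionMeasure_of_isHullMultiplicative_of_loewner
      IsArcHull.exists_loewner_chain_holds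
  have h58 : IsRestrictionMeasure.eq_five_eighths_of_outer_simple :=
    IsRestrictionMeasure.eq_five_eighths_of_outer_simple_of_exists_one
      exists_isRestrictionMeasure_one_brownianQuad
  haveI : IsProbabilityMeasure (P D) := (hP D).1
  haveI : IsProbabilityMeasure (Q D) := (hQ D).1
  obtain ⟨φ, hφ⟩ := MarkedDomain.exists_isChordalUniformizing_of_disc hsc hRM hC D
  have hPc : ∀ᵐ c ∂P D, c ∈ chordalCarrier D := ChordalFamily.ae_mem_chordalCarrier hP hPS D
  have hQc : ∀ᵐ c ∂Q D, c ∈ chordalCarrier D := ChordalFamily.ae_mem_chordalCarrier hQ hQS D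
  have hPt := har_isRestrictionMeasure_pullbackLaw hP hPcov hPres hPS hJCT hJarc hC hsc hRM hexΦ
    hFa hfac h33 h58 hφ
  have hQt := ChordalFamily.isRestrictionMeasure_pullbackLaw' hJCT hJarc hC hsc hRM hexΦ hFa
    hfac h33 h58 hQ hQcov hQres hQS hφ
  have havoid : ∀ {A : Set ℂ}, IsStarHull A →
      ChordalFamily.pullbackLaw P D φ hJarc hC hφ (avoid A) =
        ChordalFamily.pullbackLaw Q D φ hJarc hC hφ (avoid A) := fun hA => by
    obtain ⟨Φ, hΦ, -⟩ := hexΦ hA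
    obtain ⟨d, -, -, hd⟩ := hex hA hΦ
    rw [hPt.2 hA hΦ hd, hQt.2 hA hΦ hd]
  refine CurveClass.Measure.ext_of_missCode_injOn (fun n => isClosed_imageTest hC n)
    measurableSet_chordalCarrier (injOn_missCode_imageTest hJarc hC hφ) hPc hQc fun s => ?_
  obtain ⟨hanch, hcpt, hcl, h0⟩ := biUnion_anchoredSeq s
  rw [biUnion_imageTest]
  set T : Set ℂ := ⋃ n ∈ s, anchoredSeq n with hT
  have hTc : IsClosed T := hcpt.isClosed
  have hTb : Bornology.IsBounded T := hcpt.isBounded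
  rcases hanch with hempty | hanch
  · rw [hempty, image_empty]
    have : (CurveClass.rangeSubset (∅ : Set ℂ)ᶜ : Set (CurveClass ℂ)) = univ := by
      ext c; simp [CurveClass.mem_rangeSubset]
    rw [this, measure_univ, measure_univ]
  by_cases hfill : (0 : ℂ) ∈ hpFill T
  · rw [measure_rangeSubset_compl_image_eq_zero hC hφ P hPc hTc hcl h0 hfill,
      measure_rangeSubset_compl_image_eq_zero hC hφ Q hQc hTc hcl h0 hfill]
  · have hstar : IsStarHull (hpFill T) := isStarHull_hpFill hFa hTc hTb hanch.2 hfill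
    rw [measure_rangeSubset_compl_image_eq hJarc hC hφ P hPc hTc hTb hcl h0 hstar,
      measure_rangeSubset_compl_image_eq hJarc hC hφ Q hQc hTc hTb hcl h0 hstar, havoid hstar]

/-! ### Stub T' of skeleton r10 -/

/-- **Stub T' (`stub_hullRestrictionOfAvoidRestriction`, registered on stmt-CriticalPhenomena-7685):
avoidance-form restriction ⇒ hull restriction.** A chordal family which is chordal, conformally
covariant, carried by simple curves meeting the boundary only at the marked points, and satisfies the
two-sided restriction identity over hull subdomains in AVOIDANCE form,
`P D' (T) · P D {γ ∩ cl (D ∖ D') = ∅} = P D (T ∩ {γ ∩ cl (D ∖ D') = ∅})`, satisfies it in the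
tree's CLOSED form `ChordalFamily.IsHullRestriction` (`{γ ⊆ cl D'}`): by `har_eq_of_lsw` it agrees in
every domain with the chordal SLE_{8/3} family (`exists_isSLECurve_eightThirds`,
`ChordalFamily.spec_of_isSLELaw_eightThirds`), which has closed-form hull restriction ([LSW03]
Thm. 6.1, `IsSLELaw.hullRestriction_eightThirds_holds`). In particular the touching event
`{γ ⊆ cl D', γ ∩ cl (D ∖ D') ≠ ∅}` is null: no boundary estimate is needed. -/
theorem stub_hullRestrictionOfAvoidRestriction :
    ∀ P : Literature.Probability.RandomPlanarGeometry.ChordalFamily, P.IsChordal → P.IsConformallyCovariant → (∀ (D D' : Literature.Probability.RandomPlanarGeometry.DobrushinDomain), D.IsHullSubdomain D' → ∀ T : Set (Literature.Probability.RandomPlanarGeometry.CurveClass ℂ), MeasurableSet T → P D' T * P D {γ | Disjoint γ.range (closure (D.carrier \ D'.carrier))} = P D (T ∩ {γ | Disjoint γ.range (closure (D.carrier \ D'.carrier))})) → P.IsCarriedBySimpleCurves → P.IsHullRestriction := by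
  intro P hP hcov hres hS
  choose Γ hΓ using exists_isSLECurve_eightThirds
  have hQ' : ∀ D : DobrushinDomain,
      IsSLELaw ((8 : ℝ≥0) / 3) D ((fun D' => Process.preWienerMeasure.map (Γ D')) D) :=
    fun D => (hΓ D).isSLELaw_map
  obtain ⟨h1, h2, h3, h4⟩ := ChordalFamily.spec_of_isSLELaw_eightThirds hQ'
    IsSLELaw.hullRestriction_eightThirds_holds ae_isSimpleTrace_sleTrace_of_le_four_holds
  have heq : ∀ D : DobrushinDomain, P D = (fun D' => Process.preWienerMeasure.map (Γ D')) D :=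
    fun D => har_eq_of_lsw hP hcov hres hS h1 h2 h3 h4 D
  intro D D' hDD' T hT
  rw [heq D, heq D']
  exact h3 D D' hDD' T hT

end Summit.CriticalPhenomena.SAWScalingLimit.Theorems.MassiveWindowSLE.Birth

end
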